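import Summits.ResolutionOfSingularities.ResolutionOfSingularities.Theorems.PurelyInseparableDim4JointForestStep
import HarnessLib

/-!
# Purely inseparable four-folds: MODEL FACTS for hereditary waiting regions — over the parent, the translated region as a
# re-centred chart centre, closedness, readings bound supports (brick S3 (c) «joint point∘coordinate chains», part 61a = v3-H,
# model lemmas; cell `res-dim4-pi`)

[OURS · counted 0] (D-0157 DOOR 2; desk WORD #66 (4)(c), #74 (g), #99 (d); frame `PIDim4.TerminationImpliesOrderReduction`, S3 (c)
v3-H; host item stmt-ResolutionOfSingularities-16155, helper). Nothing here proves resolution of singularities in dimension ≥ 4 /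
characteristic `p` — NOT here, not anywhere in this programme. Small lemmas for part 61b (the child package with hereditary regions):

* `chart_apply_mem_CΛ_of_X_mem` — a point of the re-centred `x_j`-chart with `x_j ∈ 𝔭` maps over the parent centre `V(z, x_S)`;
* `image_specMap_translate_CΛ` — `Spec τ_c (V(z, x_T)) = V(z, x_T − c_T)` for the translation `τ_c`;
* `isClosed_image_waitingSetZ_chart` — `φ₀(V(z, x_T − c_T))` is CLOSED in the blown-up model when `S ∖ {j} ⊆ T`, `c_j = 0` (it is the
  image of `V(z, x_T)` under the chart re-centred at `b + c`; typ-2's `isClosed_image_CΛ_chart`);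
* `image_subset_support_of_comap_eq`, `mem_support_hyperplane_iff`, `eq_of_X_add_C_mem` — reading ⇒ support bounds; parallel hyperplanes.

AI-produced formalisation, weaker than expert review. bears_on: LADDER-RESOLUTION:D157-DOOR2 (res-dim4-pi · S3 (c) joint v3-H · model lemmas).
-/

set_option linter.dupNamespace false -- D-0017: single-problem summit path `Summit.<S>.<S>.…` by design

noncomputable section

open MvPolynomial Finset CategoryTheory AlgebraicGeometry Opposite TopologicalSpace
open AlgebraicGeometry.Scheme.IdealSheafData (ofIdealTop vanishingIdeal)


namespace Summit.ResolutionOfSingularities.ResolutionOfSingularities.Theorems.PIDim4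

open Literature.AlgebraicGeometry.Resolution
open Literature.AlgebraicGeometry.Resolution.Hauser2010
open Literature.AlgebraicGeometry.Resolution.AffinePointBlowup (P A γ coord Wtop ξ)

namespace Equimultiple

/-! ## §1 Model facts: over the parent, the translated region as a re-centred chart centre, closedness -/

section ModelH

variable {K : Type} [Field K] {Bl : Scheme.{0}} {B : Bl ⟶ P 4 K} {S T : Finset (Fin 4)} {j : Fin 4}

/-- **A point with `x_j ∈ 𝔭` maps over the parent centre**: for `j ∈ S`, a re-centring `Θ′` (`Θ′ xₖ = xₖ + bₖ`, `b_j = 0`) and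
`y` with `x_j ∈ 𝔭_y`, `B(φ₀ y) ∈ V(z, x_S)` (`φ₀ = Spec Θ′ ≫ chartImm_j`): every centre variable picks up the factor `x_j` on the chart
(part of typ-2's `chart_apply_mem_CΛ`, which asks `y ∈ V(z, x_{S″})`, `S ⊆ S″` only to get `x_j ∈ 𝔭_y`). [cite: Hu2025, §5 Prop. 5.3] -/
theorem chart_apply_mem_CΛ_of_X_mem
    (hB : IsBlowup B (AffineCoordBlowup.𝓘Λ 4 K (insert 0 (Fin.succ '' (S : Set (Fin 4))))))
    (hj : j ∈ S) {Θ' : A 4 K →+* A 4 K} {b : Fin 4 → K} (hbj : b j = 0)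
    (hs' : ∀ k : Fin 4, Θ' (X k.succ) = X k.succ + C (b k)) {y : P 4 K} (hXj : (X j.succ : A 4 K) ∈ y.asIdeal) :
    B ((Spec.map (CommRingCat.ofHom Θ') ≫ AffineCoordBlowup.chartImm hB (ChartDictionary.succ_mem_centreVars hj)) y) ∈
      AffineCoordBlowup.CΛ 4 K (insert 0 (Fin.succ '' (S : Set (Fin 4)))) := by
  rw [← Scheme.Hom.comp_apply, ChartDictionary.chart_comp_eq_specMap hB (ChartDictionary.succ_mem_centreVars hj) Θ',
    AffineCoordBlowup.mem_CΛ_iff']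
  intro m hm
  rw [Spec.map_apply, PrimeSpectrum.comap_asIdeal, Ideal.mem_comap, CommRingCat.hom_ofHom, RingHom.comp_apply,
    AlgHom.toRingHom_eq_coe, AlgHom.coe_toRingHom]
  rcases hm with hm | ⟨k, hk, rfl⟩
  · rw [hm, ChartDictionary.clean_subst_X_zero hbj hs']
    exact Ideal.mul_mem_right _ _ hXj
  · by_cases hkj : k = j
    · subst hkj
      rw [ChartDictionary.clean_subst_X_chart hbj hs']
      exact hXj
    · rw [ChartDictionary.clean_subst_X_fibre hbj hs' hk hkj]
      exact Ideal.mul_mem_right _ _ hXj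

/-- **The translated coordinate subspace is the translate of the coordinate subspace**: for the translation `τ_c`
(`τ_c z = z`, `τ_c xᵢ = xᵢ + cᵢ`), `Spec τ_c (V(z, x_T)) = V(z, x_T − c_T)` as sets of `𝔸⁵`. [cite: StacksProject, Tag 01J7] -/
theorem image_specMap_translate_CΛ (c : Fin 4 → K) (T : Finset (Fin 4)) :
    Spec.map (CommRingCat.ofHom
        ((AffinePointBlowup.translateEquiv (n := 4) (Fin.cases 0 c) : A 4 K ≃ₐ[K] A 4 K) : A 4 K →+* A 4 K)) ''
      (AffineCoordBlowup.CΛ 4 K (insert 0 (Fin.succ '' (T : Set (Fin 4)))) : Set (P 4 K)) =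
    {x : P 4 K | (X 0 : A 4 K) ∈ x.asIdeal ∧ ∀ i ∈ T, (X i.succ - C (c i) : A 4 K) ∈ x.asIdeal} := by
  set τ : A 4 K ≃ₐ[K] A 4 K := AffinePointBlowup.translateEquiv (n := 4) (Fin.cases 0 c) with hτ
  have hτX : ∀ k : Fin (4 + 1), τ (X k) = X k + C (Fin.cases (0 : K) c k) := fun k =>
    AffinePointBlowup.translateEquiv_X _ k
  have hτC : ∀ r : K, τ (C r) = C r := fun r => τ.commutes r
  have hτs : ∀ k : Fin (4 + 1), τ.symm (X k) = X k - C (Fin.cases (0 : K) c k) := fun k => by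
    apply τ.injective
    rw [AlgEquiv.apply_symm_apply, map_sub, hτX, hτC, add_sub_cancel_right]
  have hmem : ∀ (σ : A 4 K ≃ₐ[K] A 4 K) (x : P 4 K) (f : A 4 K),
      f ∈ (Spec.map (CommRingCat.ofHom (σ : A 4 K →+* A 4 K)) x).asIdeal ↔ σ f ∈ x.asIdeal := fun σ x f => by
    rw [Spec.map_apply, PrimeSpectrum.comap_asIdeal, Ideal.mem_comap, CommRingCat.hom_ofHom]
    rfl
  have hinv : ∀ x : P 4 K, Spec.map (CommRingCat.ofHom (τ : A 4 K →+* A 4 K))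
      (Spec.map (CommRingCat.ofHom (τ.symm : A 4 K →+* A 4 K)) x) = x := fun x => by
    rw [← Scheme.Hom.comp_apply, ← Spec.map_comp, ← CommRingCat.ofHom_comp]
    have h : (τ.symm : A 4 K →+* A 4 K).comp (τ : A 4 K →+* A 4 K) = RingHom.id _ :=
      RingHom.ext fun f => τ.symm_apply_apply f
    rw [h, CommRingCat.ofHom_id]
    change (Spec.map (𝟙 _)) x = x
    rw [Spec.map_id]
    rfl
  ext x
  constructor
  · rintro ⟨y, hy, rfl⟩
    have hy' := (AffineCoordBlowup.mem_CΛ_iff' 4 K _ y).mp hy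
    refine ⟨?_, fun i hi => ?_⟩
    · rw [hmem, hτX, Fin.cases_zero, C_0, add_zero]
      exact hy' 0 (Set.mem_insert _ _)
    · rw [hmem, map_sub, hτC, hτX, Fin.cases_succ, add_sub_cancel_right]
      exact hy' i.succ (Set.mem_insert_of_mem _ ⟨i, hi, rfl⟩)
  · rintro ⟨h0, hT⟩
    refine ⟨Spec.map (CommRingCat.ofHom (τ.symm : A 4 K →+* A 4 K)) x, ?_, hinv x⟩
    rw [SetLike.mem_coe, AffineCoordBlowup.mem_CΛ_iff']
    rintro k (rfl | ⟨i, hi, rfl⟩)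
    · rw [hmem, hτs, Fin.cases_zero, C_0, sub_zero]
      exact h0
    · rw [hmem, hτs, Fin.cases_succ]
      exact hT i hi

/-- **The translated region is CLOSED in the blown-up model.** For `j ∈ S`, a translation-cleaning `Θ` at `b` (`Θ z = z + h(x)`,
`Θ xᵢ = xᵢ + bᵢ`, `b_j = 0`) and a translation vector `c` with `c_j = 0`: if `S ∖ {j} ⊆ T` then `φ₀(V(z, x_T − c_T))` is closed in
`Bl` (`φ₀ = Spec Θ ≫ chartImm_j`) — it is the image of `V(z, x_T)` under the chart re-centred at `b + c`, typ-2's closedness criterion.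
[cite: BierstoneGrigorievMilmanWlodarczyk2011, Def. 3.1.5 Rem. (1)] [cite: Hu2025, §5 Prop. 5.3] -/
theorem isClosed_image_waitingSetZ_chart
    (hB : IsBlowup B (AffineCoordBlowup.𝓘Λ 4 K (insert 0 (Fin.succ '' (S : Set (Fin 4))))))
    (hj : j ∈ S) {Θ : A 4 K ≃ₐ[K] A 4 K} {b : Fin 4 → K} (hbj : b j = 0) {h : MvPolynomial (Fin 4) K}
    (h0 : Θ (X 0) = X 0 + rename Fin.succ h) (hs : ∀ i : Fin 4, Θ (X i.succ) = X i.succ + C (b i))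
    {c : Fin 4 → K} (hcj : c j = 0) (hsubT : S.erase j ⊆ T) :
    IsClosed ((Spec.map (CommRingCat.ofHom (Θ : A 4 K →+* A 4 K)) ≫
        AffineCoordBlowup.chartImm hB (ChartDictionary.succ_mem_centreVars hj)) ''
      {x : P 4 K | (X 0 : A 4 K) ∈ x.asIdeal ∧ ∀ i ∈ T, (X i.succ - C (c i) : A 4 K) ∈ x.asIdeal}) := by
  set τ : A 4 K ≃ₐ[K] A 4 K := AffinePointBlowup.translateEquiv (n := 4) (Fin.cases 0 c) with hτ
  have hτX : ∀ k : Fin (4 + 1), τ (X k) = X k + C (Fin.cases (0 : K) c k) := fun k =>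
    AffinePointBlowup.translateEquiv_X _ k
  have hτC : ∀ r : K, τ (C r) = C r := fun r => τ.commutes r
  set Θ'' : A 4 K ≃ₐ[K] A 4 K := Θ.trans τ with hΘ''
  have hτh : τ (rename Fin.succ h) = rename Fin.succ (aeval (fun i => (X i + C (c i) : MvPolynomial (Fin 4) K)) h) := by
    have hcomp : (τ : A 4 K →ₐ[K] A 4 K).comp (rename Fin.succ) =
        (rename Fin.succ).comp (aeval fun i => (X i + C (c i) : MvPolynomial (Fin 4) K)) := by
      refine MvPolynomial.algHom_ext fun i => ?_
      simp only [AlgHom.comp_apply, rename_X, aeval_X, map_add, rename_C]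
      change τ (X i.succ) = _
      rw [hτX, Fin.cases_succ]
    exact DFunLike.congr_fun hcomp h
  have h0'' : Θ'' (X 0) = X 0 + rename Fin.succ (aeval (fun i => (X i + C (c i) : MvPolynomial (Fin 4) K)) h) := by
    rw [hΘ'', AlgEquiv.trans_apply, h0, map_add, hτX, Fin.cases_zero, C_0, add_zero, hτh]
  have hs'' : ∀ i : Fin 4, Θ'' (X i.succ) = X i.succ + C ((fun k => b k + c k) i) := fun i => by
    rw [hΘ'', AlgEquiv.trans_apply, hs, map_add, hτX, Fin.cases_succ, hτC, add_assoc, ← C_add,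
      add_comm (c i)]
  have hbcj : (fun k => b k + c k) j = 0 := by simp only [hbj, hcj, add_zero]
  have hcl := ChartDictionary.isClosed_image_CΛ_chart hj hbcj h0'' hs'' hB hsubT
  have hcomp : Spec.map (CommRingCat.ofHom (Θ'' : A 4 K →+* A 4 K)) =
      Spec.map (CommRingCat.ofHom (τ : A 4 K →+* A 4 K)) ≫ Spec.map (CommRingCat.ofHom (Θ : A 4 K →+* A 4 K)) := by
    rw [← Spec.map_comp, ← CommRingCat.ofHom_comp]
    rfl
  rw [hcomp, Category.assoc, Scheme.Hom.comp_base, TopCat.coe_comp, Set.image_comp, image_specMap_translate_CΛ] at hcl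
  exact hcl

end ModelH

/-! ## §2 Readings bound supports; parallel hyperplanes -/

section SupportH

variable {K : Type} [Field K] {W : Scheme.{0}}

/-- **A reading bounds the support from below**: if `D₂` reads `ψ″^* J` on the zigzag chart and `A ⊆ V(J)`, then `φ″(ψ″⁻¹ A) ⊆ V(D₂)`.
[folklore] -/
theorem image_subset_support_of_comap_eq {Y'' : Scheme.{0}} (φ'' : Y'' ⟶ W) (ψ'' : Y'' ⟶ P 4 K)
    (D₂ : W.IdealSheafData) (J : (P 4 K).IdealSheafData) (h : D₂.comap φ'' = J.comap ψ'') (Aset : Set (P 4 K))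
    (hA : ∀ y ∈ Aset, y ∈ (J.support : Set (P 4 K))) : φ'' '' (ψ'' ⁻¹' Aset) ⊆ (D₂.support : Set W) := by
  rintro _ ⟨y, hy, rfl⟩
  have h1 : y ∈ (D₂.comap φ'').support := by
    rw [h, Scheme.IdealSheafData.support_comap]
    exact hA _ hy
  rw [Scheme.IdealSheafData.support_comap] at h1
  exact h1

/-- Points of the hyperplane ideal sheaf `(γ⁻¹(xᵢ + e))·𝒪`: `x ∈ V` iff `xᵢ + e ∈ 𝔭_x`. [folklore] -/
theorem mem_support_hyperplane_iff (i : Fin 4) (e : K) (x : P 4 K) :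
    x ∈ ((ofIdealTop (Ideal.span {(γ 4 K).symm (X i.succ + C e)})).support : Set (P 4 K)) ↔
      (X i.succ + C e : A 4 K) ∈ x.asIdeal := by
  rw [SetLike.mem_coe, ofIdealTop_span_γ_symm_eq_shf, Literature.AlgebraicGeometry.Hironaka2017.SpecOrders.mem_support_shf_iff,
    Ideal.span_singleton_le_iff_mem]

/-- Two parallel hyperplanes through one point coincide: `xᵢ + e ∈ 𝔭` and `xᵢ + e' ∈ 𝔭` force `e = e'`. [folklore] -/
theorem eq_of_X_add_C_mem {i : Fin 4} {e e' : K} {x : P 4 K} (h : (X i.succ + C e : A 4 K) ∈ x.asIdeal)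
    (h' : (X i.succ + C e' : A 4 K) ∈ x.asIdeal) : e = e' := by
  by_contra hne
  have hC : (C (e - e') : A 4 K) ∈ x.asIdeal := by
    have h2 := x.asIdeal.sub_mem h h'
    rwa [show (X i.succ + C e : A 4 K) - (X i.succ + C e') = C (e - e') by rw [C_sub]; ring] at h2
  refine x.isPrime.ne_top ((Ideal.eq_top_iff_one _).mpr ?_)
  have h3 := x.asIdeal.mul_mem_left (C (e - e')⁻¹) hC
  rwa [← C_mul, inv_mul_cancel₀ (sub_ne_zero.mpr hne), C_1] at h3

end SupportH

end Equimultiple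

end Summit.ResolutionOfSingularities.ResolutionOfSingularities.Theorems.PIDim4

end
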